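/-
Copyright (c) 2026. Released under the project licence.
-/
import Mathlib
import Literature.NumberTheory.DiophantineApproximation.KoksmaHlawkaInequality

/-!
# The `L₂`-discrepancy: Warnock's formula, Hickernell's generalised `L₂`-discrepancy and the `L₂` Koksma–Hlawka inequality

Topic `Literature/NumberTheory/DiophantineApproximation`; PROVED theorems (no named fact).

For `N` points `x_0, …, x_{N-1} ∈ [0,1)^s` with local discrepancy
`Δ_P(z) = #{n : x_n ∈ [0,z)}/N − ∏_i z_i` (`Discrepancy.boxDelta`, file
`KoksmaHlawkaInequality.lean`) and a set of coordinates `u ⊆ {1,…,s}`, the squared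
`L₂`-discrepancy of the face `u` is `∫_{[0,1]^{|u|}} Δ_P(z_u,1)² dz_u`
(`Discrepancy.faceL2Sq`; we integrate over the whole cube `[0,1]^s`, the free coordinates
integrating to `1`).  Unlike the star discrepancy these quantities have CLOSED FORMS in the
coordinates of the points:

* `Discrepancy.faceL2Sq_eq` — for every face `u`,
  `∫ Δ_P(z_u,1)² = (1/N²) Σ_{m,n} ∏_{i∈u} (1 − max(x_{m,i}, x_{n,i}))
      − (2/N) Σ_n ∏_{i∈u} (1 − x_{n,i}²)/2 + 3^{−|u|}`
  [cite: DickPillichshammer2010, Prop. 3.60 (one summand; `min(1−a,1−b) = 1 − max(a,b)`)];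
* `Discrepancy.l2DiscrepancySq_eq` — WARNOCK's formula for the classical `L₂`-discrepancy
  `(L_{2,N}(P))² = ∫_{[0,1]^s} Δ_P(z)² dz` (the face `u = {1,…,s}`)
  [cite: DickPillichshammer2010, Prop. 2.15; Lemieux2009, §5.6.1 (Warnock's formula for `(T*(P_n))²`)];
* `Discrepancy.genL2DiscrepancySq_eq` — HICKERNELL's formula for the generalised (anchored)
  `L₂`-discrepancy `D₂(P)² = Σ_{∅≠u} ∫ Δ_P(z_u,1)² dz_u
    = (1/N²) Σ_{m,n} ∏_i (2 − max(x_{m,i}, x_{n,i})) − (2/N) Σ_n ∏_i (3 − x_{n,i}²)/2 + (4/3)^s`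
  [cite: Hickernell1998, eq. (5.1c); Lemieux2009, §5.6.1 eq. (5.23) and the display after it;
  DickPillichshammer2010, Def. 3.59 / Prop. 3.60 with all weights `γ_u = 1`];

and the Hlawka–Zaremba identity (`Discrepancy.hlawka_zaremba_identity`) with the Cauchy–Schwarz
inequality in place of the estimate `|Δ_P| ≤ D*_N` gives the `L₂` version of the Koksma–Hlawka
inequality for integrands with continuous mixed partial derivatives `F u = ∂^{|u|}f/∂x_u`:

* `Discrepancy.koksma_hlawka_l2_faces` —
  `|(1/N) Σ_n f(x_n) − ∫ f| ≤ Σ_{∅≠u} (∫ Δ_P(z_u,1)² dz)^{1/2} (∫ (∂_u f(z_u,1))² dz)^{1/2}`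
  [cite: DickPillichshammer2010, Prop. 2.17 and p. 33 (`|I(f) − Q_N(f)| ≤ ‖f‖·‖h‖`)];
* `Discrepancy.koksma_hlawka_l2` — `|(1/N) Σ_n f(x_n) − ∫ f| ≤ D₂(P) · V₂(f)` with
  `V₂(f)² = Σ_{∅≠u} ∫ (∂_u f(z_u,1))² dz`
  [cite: Hickernell1998, eq. (5.1c) (the quadrature error bound `|I − Q| ≤ D₂(P) V₂(f)`);
  Lemieux2009, §5.6.1, `E_n ≤ D_2(P_n) V_2(f)`].

So a CERTIFIED worst-case QMC error bound needs only rational arithmetic on the point set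
(`O(s N²)` operations [cite: DickPillichshammer2010, Remark 2.16]) and bounds for the
`2^s − 1` integrals `∫ (∂_u f)²` — in contrast with the star discrepancy, whose computation is
NP-hard [cite: DickPillichshammer2010, Remark 2.16].

Proof route: `Δ_P(z_u,1) = (1/N) Σ_n ∏_{i∈u} 1[x_{n,i} < z_i] − ∏_{i∈u} z_i`
(`Discrepancy.boxDelta_projOne`); squaring gives three families of products over `i ∈ u` of
functions of one coordinate each, and `∫_{[0,1]^s} ∏_{i∈u} g_i(z_i) dz = ∏_{i∈u} ∫_0^1 g_i`
(Fubini on the product measure, `MeasureTheory.integral_fintype_prod_eq_prod`) with the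
one-dimensional integrals `∫_0^1 1[a<t] 1[b<t] dt = 1 − max(a,b)`, `∫_0^1 t·1[a<t] dt = (1−a²)/2`,
`∫_0^1 t² dt = 1/3` (`a, b ∈ [0,1]`).  Hickernell's formula is the sum over all faces with
`Σ_{u} ∏_{i∈u} a_i = ∏_i (1 + a_i)` (`Finset.prod_one_add`), the face `u = ∅` contributing
`1 − 2 + 1 = 0`.  The `L₂` inequalities are Hölder's inequality with `p = q = 2`
(`MeasureTheory.integral_mul_le_Lp_mul_Lq_of_nonneg`) and the Cauchy–Schwarz inequality for the
sum over the faces (`Finset.sum_mul_sq_le_sq_mul_sq`).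

Not formalised here: the unanchored / extreme `L₂`-discrepancies and the weighted versions with
general weights `γ_u` [cite: DickPillichshammer2010, Def. 3.59].
-/

noncomputable section

namespace Literature.NumberTheory.DiophantineApproximation

namespace Discrepancy

open MeasureTheory Set intervalIntegral Function Finset

variable {N s : ℕ}

/-! ### Definitions -/

/-- The squared `L₂`-discrepancy of the face `u`: `∫_{[0,1]^s} Δ_P(z_u,1)² dz`
(`= ∫_{[0,1]^{|u|}} Δ_P(z_u,1)² dz_u`, the free coordinates integrating to `1`).
[cite: DickPillichshammer2010, Def. 3.59 (`q = 2`, one summand)] -/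
def faceL2Sq (x : Fin N → Fin s → ℝ) (u : Finset (Fin s)) : ℝ :=
  ∫ z in Icc (0 : Fin s → ℝ) 1, boxDelta x (projOne u z) ^ 2

/-- The squared classical `L₂`-discrepancy `(L_{2,N}(P))² = ∫_{[0,1]^s} Δ_P(z)² dz`.
[cite: DickPillichshammer2010, Def. 2.14] -/
def l2DiscrepancySq (x : Fin N → Fin s → ℝ) : ℝ :=
  ∫ z in Icc (0 : Fin s → ℝ) 1, boxDelta x z ^ 2

/-- The squared generalised (anchored at `1`) `L₂`-discrepancy of Hickernell,
`D₂(P)² = Σ_{∅≠u} ∫_{[0,1]^{|u|}} Δ_P(z_u,1)² dz_u`.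
[cite: Hickernell1998, eq. (5.1c); Lemieux2009, §5.6.1 eq. (5.23);
DickPillichshammer2010, Def. 3.59 (`q = 2`, `γ_u = 1`)] -/
def genL2DiscrepancySq (x : Fin N → Fin s → ℝ) : ℝ :=
  ∑ u ∈ univ.filter Finset.Nonempty, faceL2Sq x u

variable (x : Fin N → Fin s → ℝ)

/-! ### Lebesgue measure on the cube and product integrands -/

/-- Lebesgue measure on the unit cube is the product of `s` copies of Lebesgue measure on
`[0,1]`. [folklore] -/
private theorem volume_restrict_unitCube' (s : ℕ) :
    (volume : Measure (Fin s → ℝ)).restrict (Icc 0 1) =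
      Measure.pi fun _ : Fin s => (volume : Measure ℝ).restrict (Icc 0 1) := by
  rw [← Set.pi_univ_Icc, volume_pi, Measure.restrict_pi_pi]
  rfl

/-- The unit cube has finite Lebesgue measure. [folklore] -/
private theorem isFiniteMeasure_cube (s : ℕ) :
    IsFiniteMeasure ((volume : Measure (Fin s → ℝ)).restrict (Icc 0 1)) :=
  isFiniteMeasure_restrict.mpr (isCompact_Icc.measure_lt_top).ne

/-- `∫_{[0,1]^s} ∏_{i∈u} g_i(z_i) dz = ∏_{i∈u} ∫_0^1 g_i` (Fubini on the product measure).
[folklore] -/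
private theorem integral_cube_prod (u : Finset (Fin s)) (g : Fin s → ℝ → ℝ) :
    ∫ z in Icc (0 : Fin s → ℝ) 1, ∏ i ∈ u, g i (z i) =
      ∏ i ∈ u, ∫ t in Icc (0 : ℝ) 1, g i t := by
  classical
  have h1 : (fun z : Fin s → ℝ => ∏ i ∈ u, g i (z i)) =
      fun z => ∏ i, (if i ∈ u then g i (z i) else (1 : ℝ)) := by
    funext z; rw [prod_ite_mem, Finset.univ_inter]
  have h2 := integral_fintype_prod_eq_prod (𝕜 := ℝ)
    (μ := fun _ : Fin s => (volume : Measure ℝ).restrict (Icc 0 1))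
    (fun i t => if i ∈ u then g i t else (1 : ℝ))
  rw [h1, volume_restrict_unitCube', h2]
  have h3 : ∀ i, (∫ t, (if i ∈ u then g i t else (1 : ℝ))
      ∂((volume : Measure ℝ).restrict (Icc 0 1))) =
      if i ∈ u then ∫ t in Icc (0 : ℝ) 1, g i t else 1 := by
    intro i
    by_cases hi : i ∈ u
    · simp only [hi, if_true]
    · simp only [hi, if_false]
      simp
  simp_rw [h3]
  rw [prod_ite_mem, Finset.univ_inter]

/-- A bounded measurable function is integrable on the unit cube. [folklore] -/
private theorem integrableOn_cube_of_bounded {φ : (Fin s → ℝ) → ℝ} (hφ : Measurable φ) (C : ℝ)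
    (hC : ∀ z, |φ z| ≤ C) : IntegrableOn φ (Icc (0 : Fin s → ℝ) 1) := by
  haveI := isFiniteMeasure_cube s
  have h : MemLp φ 1 ((volume : Measure (Fin s → ℝ)).restrict (Icc 0 1)) :=
    MemLp.of_bound hφ.aestronglyMeasurable C
      (Filter.Eventually.of_forall fun z => by rw [Real.norm_eq_abs]; exact hC z)
  exact memLp_one_iff_integrable.mp h

/-- Measurability of `z ↦ 1[a < z_i]`. [folklore] -/
private theorem measurable_ind (a : ℝ) (i : Fin s) :
    Measurable fun z : Fin s → ℝ => if a < z i then (1 : ℝ) else 0 :=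
  Measurable.ite (measurableSet_lt measurable_const (measurable_pi_apply i)) measurable_const
    measurable_const

/-- `|1[a < t]| ≤ 1`. [folklore] -/
private theorem abs_ind_le_one (a t : ℝ) : |(if a < t then (1 : ℝ) else 0)| ≤ 1 := by
  by_cases h : a < t <;> simp [h]

/-! ### One-dimensional integrals -/

/-- `[0,1] ∩ (c,∞) = (c,1]` for `c ≥ 0`. [folklore] -/
private theorem Icc_inter_Ioi {c : ℝ} (hc : 0 ≤ c) : Icc (0 : ℝ) 1 ∩ Ioi c = Ioc c 1 := by
  ext t
  simp only [mem_inter_iff, Set.mem_Icc, Set.mem_Ioi, Set.mem_Ioc]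
  constructor
  · rintro ⟨⟨-, h1⟩, h2⟩; exact ⟨h2, h1⟩
  · rintro ⟨h2, h1⟩; exact ⟨⟨hc.trans h2.le, h1⟩, h2⟩

/-- `∫_0^1 1[c < t] dt = 1 − c` for `c ∈ [0,1]`. [folklore] -/
private theorem integral_ind {c : ℝ} (hc0 : 0 ≤ c) (hc1 : c ≤ 1) :
    ∫ t in Icc (0 : ℝ) 1, (if c < t then (1 : ℝ) else 0) = 1 - c := by
  have h : (fun t : ℝ => if c < t then (1 : ℝ) else 0) = (Ioi c).indicator fun _ => (1 : ℝ) := by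
    funext t; simp [Set.indicator, Set.mem_Ioi]
  rw [h, setIntegral_indicator measurableSet_Ioi, Icc_inter_Ioi hc0, setIntegral_const,
    measureReal_def, Real.volume_Ioc, ENNReal.toReal_ofReal (by linarith), smul_eq_mul, mul_one]

/-- `∫_0^1 1[a < t] 1[b < t] dt = 1 − max(a,b)` for `a, b ∈ [0,1]`. [folklore] -/
private theorem integral_ind_mul_ind {a b : ℝ} (ha0 : 0 ≤ a) (ha1 : a ≤ 1) (hb1 : b ≤ 1) :
    ∫ t in Icc (0 : ℝ) 1, (if a < t then (1 : ℝ) else 0) * (if b < t then (1 : ℝ) else 0) =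
      1 - max a b := by
  have h : (fun t : ℝ => (if a < t then (1 : ℝ) else 0) * (if b < t then (1 : ℝ) else 0)) =
      fun t => if max a b < t then (1 : ℝ) else 0 := by
    funext t
    by_cases ha : a < t <;> by_cases hb : b < t <;> simp [ha, hb]
  rw [h]
  exact integral_ind (ha0.trans (le_max_left a b)) (max_le ha1 hb1)

/-- `∫_0^1 t · 1[c < t] dt = (1 − c²)/2` for `c ∈ [0,1]`. [folklore] -/
private theorem integral_id_mul_ind {c : ℝ} (hc0 : 0 ≤ c) (hc1 : c ≤ 1) :
    ∫ t in Icc (0 : ℝ) 1, t * (if c < t then (1 : ℝ) else 0) = (1 - c ^ 2) / 2 := by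
  have h : (fun t : ℝ => t * (if c < t then (1 : ℝ) else 0)) = (Ioi c).indicator id := by
    funext t; by_cases ht : c < t <;> simp [Set.indicator, Set.mem_Ioi, ht]
  rw [h, setIntegral_indicator measurableSet_Ioi, Icc_inter_Ioi hc0, ← integral_of_le hc1]
  simp only [id]
  rw [integral_id]
  ring

/-- `∫_0^1 t² dt = 1/3`. [folklore] -/
private theorem integral_sq_unit : ∫ t in Icc (0 : ℝ) 1, t ^ 2 = 1 / 3 := by
  rw [integral_Icc_eq_integral_Ioc, ← integral_of_le zero_le_one, integral_pow]
  norm_num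

/-! ### Warnock-type closed forms -/

/-- **The squared `L₂`-discrepancy of a face, in closed form.**  For points `x_n ∈ [0,1)^s` and
`u ⊆ {1,…,s}`,
`∫_{[0,1]^s} Δ_P(z_u,1)² dz = (1/N²) Σ_m Σ_n ∏_{i∈u} (1 − max(x_{m,i},x_{n,i}))
  − 2 (Σ_n ∏_{i∈u} (1 − x_{n,i}²)/2)/N + (1/3)^{|u|}`.
[cite: DickPillichshammer2010, Prop. 3.60 (the `u`-summand, `min(1−a,1−b) = 1 − max(a,b)`)] -/
theorem faceL2Sq_eq (hx0 : ∀ n i, 0 ≤ x n i) (hx1 : ∀ n i, x n i < 1) (u : Finset (Fin s)) :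
    faceL2Sq x u =
      (∑ m, ∑ n, ∏ i ∈ u, (1 - max (x m i) (x n i))) / N ^ 2 -
        2 * (∑ n, ∏ i ∈ u, (1 - x n i ^ 2) / 2) / N + (1 / 3 : ℝ) ^ u.card := by
  -- the three families of product integrands
  set A : Fin N → Fin N → (Fin s → ℝ) → ℝ := fun m n z =>
    ∏ i ∈ u, ((if x m i < z i then (1 : ℝ) else 0) * (if x n i < z i then (1 : ℝ) else 0)) with hA
  set B : Fin N → (Fin s → ℝ) → ℝ := fun n z =>
    ∏ i ∈ u, (z i * (if x n i < z i then (1 : ℝ) else 0)) with hB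
  set C : (Fin s → ℝ) → ℝ := fun z => ∏ i ∈ u, z i ^ 2 with hC
  -- pointwise expansion of the square
  have hpt : ∀ z, boxDelta x (projOne u z) ^ 2 =
      (∑ m, ∑ n, A m n z) / N ^ 2 - 2 * (∑ n, B n z) / N + C z := by
    intro z
    rw [boxDelta_projOne x hx1 u z]
    have hS2 : (∑ n, ∏ i ∈ u, (if x n i < z i then (1 : ℝ) else 0)) ^ 2 = ∑ m, ∑ n, A m n z := by
      rw [sq, sum_mul_sum]
      refine sum_congr rfl fun m _ => sum_congr rfl fun n _ => ?_
      simp only [hA]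
      rw [prod_mul_distrib]
    have hSP : (∑ n, ∏ i ∈ u, (if x n i < z i then (1 : ℝ) else 0)) * (∏ i ∈ u, z i) =
        ∑ n, B n z := by
      rw [sum_mul]
      refine sum_congr rfl fun n _ => ?_
      simp only [hB]
      rw [prod_mul_distrib, mul_comm]
    have hP2 : (∏ i ∈ u, z i) ^ 2 = C z := by simp only [hC]; rw [Finset.prod_pow]
    have : ((∑ n, ∏ i ∈ u, (if x n i < z i then (1 : ℝ) else 0)) / N - ∏ i ∈ u, z i) ^ 2 =
        (∑ n, ∏ i ∈ u, (if x n i < z i then (1 : ℝ) else 0)) ^ 2 / N ^ 2 -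
          2 * ((∑ n, ∏ i ∈ u, (if x n i < z i then (1 : ℝ) else 0)) * ∏ i ∈ u, z i) / N +
          (∏ i ∈ u, z i) ^ 2 := by ring
    rw [this, hS2, hSP, hP2]
  -- integrability of the three families
  have hAi : ∀ m n, IntegrableOn (A m n) (Icc (0 : Fin s → ℝ) 1) := fun m n =>
    integrableOn_cube_of_bounded
      (Finset.measurable_prod u fun i _ => (measurable_ind (x m i) i).mul (measurable_ind (x n i) i))
      1 fun z => by
        rw [hA]; dsimp only; rw [Finset.abs_prod]
        exact prod_le_one (fun i _ => abs_nonneg _) fun i _ => by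
          rw [abs_mul]
          exact mul_le_one₀ (abs_ind_le_one _ _) (abs_nonneg _) (abs_ind_le_one _ _)
  have hBi : ∀ n, IntegrableOn (B n) (Icc (0 : Fin s → ℝ) 1) := by
    intro n
    -- `B n` = (continuous `∏_{i∈u} z_i`) × (bounded measurable `∏_{i∈u} 1[x_{n,i} < z_i]`)
    have hcont : ContinuousOn (fun z : Fin s → ℝ => ∏ i ∈ u, z i) (Icc 0 1) :=
      (continuous_finsetProd u fun i _ => continuous_apply i).continuousOn
    have hmeas : Measurable fun z : Fin s → ℝ => ∏ i ∈ u, (if x n i < z i then (1 : ℝ) else 0) :=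
      Finset.measurable_prod u fun i _ => measurable_ind (x n i) i
    have hprod : IntegrableOn
        (fun z : Fin s → ℝ => (∏ i ∈ u, (if x n i < z i then (1 : ℝ) else 0)) * ∏ i ∈ u, z i)
        (Icc (0 : Fin s → ℝ) 1) := by
      refine Integrable.bdd_mul (c := 1) (hcont.integrableOn_compact isCompact_Icc)
        hmeas.aestronglyMeasurable (Filter.Eventually.of_forall fun z => ?_)
      rw [Real.norm_eq_abs, Finset.abs_prod]
      exact prod_le_one (fun i _ => abs_nonneg _) fun i _ => abs_ind_le_one _ _
    refine hprod.congr_fun (fun z _ => ?_) measurableSet_Icc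
    rw [hB]; dsimp only; rw [prod_mul_distrib, mul_comm]
  have hCi : IntegrableOn C (Icc (0 : Fin s → ℝ) 1) :=
    ((continuous_finsetProd u fun i _ => (continuous_apply i).pow 2).continuousOn).integrableOn_compact
      isCompact_Icc
  -- the three integrals
  have hAI : ∀ m n, ∫ z in Icc (0 : Fin s → ℝ) 1, A m n z = ∏ i ∈ u, (1 - max (x m i) (x n i)) := by
    intro m n
    rw [hA]; dsimp only
    rw [integral_cube_prod u fun i t =>
      (if x m i < t then (1 : ℝ) else 0) * (if x n i < t then (1 : ℝ) else 0)]
    exact prod_congr rfl fun i _ =>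
      integral_ind_mul_ind (hx0 m i) (hx1 m i).le (hx1 n i).le
  have hBI : ∀ n, ∫ z in Icc (0 : Fin s → ℝ) 1, B n z = ∏ i ∈ u, (1 - x n i ^ 2) / 2 := by
    intro n
    rw [hB]; dsimp only
    rw [integral_cube_prod u fun i t => t * (if x n i < t then (1 : ℝ) else 0)]
    exact prod_congr rfl fun i _ => integral_id_mul_ind (hx0 n i) (hx1 n i).le
  have hCI : ∫ z in Icc (0 : Fin s → ℝ) 1, C z = (1 / 3 : ℝ) ^ u.card := by
    rw [hC]; dsimp only
    rw [integral_cube_prod u fun _ t => t ^ 2]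
    simp_rw [integral_sq_unit]
    rw [prod_const]
  -- assemble
  have hI1 : IntegrableOn (fun z => (∑ m, ∑ n, A m n z) / (N : ℝ) ^ 2) (Icc (0 : Fin s → ℝ) 1) :=
    (integrable_finsetSum _ fun m _ => integrable_finsetSum _ fun n _ => hAi m n).div_const _
  have hI2 : IntegrableOn (fun z => 2 * (∑ n, B n z) / (N : ℝ)) (Icc (0 : Fin s → ℝ) 1) :=
    ((integrable_finsetSum _ fun n _ => hBi n).const_mul 2).div_const _
  have hI12 : IntegrableOn (fun z => (∑ m, ∑ n, A m n z) / (N : ℝ) ^ 2 - 2 * (∑ n, B n z) / (N : ℝ))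
      (Icc (0 : Fin s → ℝ) 1) := hI1.sub hI2
  have hIA : ∫ z in Icc (0 : Fin s → ℝ) 1, (∑ m, ∑ n, A m n z) =
      ∑ m, ∑ n, ∏ i ∈ u, (1 - max (x m i) (x n i)) := by
    rw [integral_finsetSum _ (fun m _ => integrable_finsetSum _ fun n _ => hAi m n)]
    refine sum_congr rfl fun m _ => ?_
    rw [integral_finsetSum _ (fun n _ => hAi m n)]
    exact sum_congr rfl fun n _ => hAI m n
  have hIB : ∫ z in Icc (0 : Fin s → ℝ) 1, (∑ n, B n z) = ∑ n, ∏ i ∈ u, (1 - x n i ^ 2) / 2 := by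
    rw [integral_finsetSum _ (fun n _ => hBi n)]
    exact sum_congr rfl fun n _ => hBI n
  unfold faceL2Sq
  rw [integral_congr_ae ((ae_restrict_iff' measurableSet_Icc).2
    (Filter.Eventually.of_forall fun z _ => hpt z)),
    integral_add hI12 hCi, integral_sub hI1 hI2, MeasureTheory.integral_div,
    MeasureTheory.integral_div, MeasureTheory.integral_const_mul, hIA, hIB, hCI]

/-- `(z_{I_s}, 1) = z`. [folklore] -/
private theorem projOne_univ (z : Fin s → ℝ) : projOne univ z = z := by
  funext i; simp [projOne]

/-- **Warnock's formula.**  For points `x_n ∈ [0,1)^s`,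
`(L_{2,N}(P))² = ∫_{[0,1]^s} Δ_P(z)² dz
  = (1/N²) Σ_m Σ_n ∏_i (1 − max(x_{m,i},x_{n,i})) − 2 (Σ_n ∏_i (1 − x_{n,i}²)/2)/N + 3^{−s}`
(`min(1 − a, 1 − b) = 1 − max(a,b)`).
[cite: DickPillichshammer2010, Prop. 2.15; Lemieux2009, §5.6.1 (Warnock's formula)] -/
theorem l2DiscrepancySq_eq (hx0 : ∀ n i, 0 ≤ x n i) (hx1 : ∀ n i, x n i < 1) :
    l2DiscrepancySq x =
      (∑ m, ∑ n, ∏ i, (1 - max (x m i) (x n i))) / N ^ 2 -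
        2 * (∑ n, ∏ i, (1 - x n i ^ 2) / 2) / N + (1 / 3 : ℝ) ^ s := by
  have h : l2DiscrepancySq x = faceL2Sq x univ := by
    unfold l2DiscrepancySq faceL2Sq
    simp_rw [projOne_univ]
  rw [h, faceL2Sq_eq x hx0 hx1 univ, Finset.card_univ, Fintype.card_fin]

/-- The face `u = ∅` has zero `L₂`-discrepancy (`Δ_P(1) = 0` for `N ≥ 1`). [folklore] -/
private theorem faceL2Sq_empty (hN : 0 < N) (hx1 : ∀ n i, x n i < 1) : faceL2Sq x ∅ = 0 := by
  unfold faceL2Sq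
  simp_rw [boxDelta_projOne_empty x hN hx1]
  simp

/-- **Hickernell's formula for the generalised `L₂`-discrepancy.**  For `N ≥ 1` points
`x_n ∈ [0,1)^s`,
`D₂(P)² = Σ_{∅≠u} ∫ Δ_P(z_u,1)² dz_u
  = (1/N²) Σ_m Σ_n ∏_i (2 − max(x_{m,i},x_{n,i})) − 2 (Σ_n ∏_i (3 − x_{n,i}²)/2)/N + (4/3)^s`.
[cite: Hickernell1998, eq. (5.1c); Lemieux2009, §5.6.1 (display after eq. (5.23));
DickPillichshammer2010, Prop. 3.60 with `γ_u = 1` summed by `Σ_u ∏_{i∈u} a_i = ∏_i (1 + a_i)`] -/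
theorem genL2DiscrepancySq_eq (hN : 0 < N) (hx0 : ∀ n i, 0 ≤ x n i) (hx1 : ∀ n i, x n i < 1) :
    genL2DiscrepancySq x =
      (∑ m, ∑ n, ∏ i, (2 - max (x m i) (x n i))) / N ^ 2 -
        2 * (∑ n, ∏ i, (3 - x n i ^ 2) / 2) / N + (4 / 3 : ℝ) ^ s := by
  -- the sum over the non-empty faces is the sum over all faces
  have hall : genL2DiscrepancySq x = ∑ u, faceL2Sq x u := by
    unfold genL2DiscrepancySq
    rw [sum_filter]
    refine sum_congr rfl fun u _ => ?_
    by_cases hu : u.Nonempty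
    · simp [hu]
    · rw [Finset.not_nonempty_iff_eq_empty] at hu
      subst hu
      simp [faceL2Sq_empty x hN hx1]
  rw [hall]
  simp_rw [faceL2Sq_eq x hx0 hx1]
  rw [sum_add_distrib, sum_sub_distrib, ← sum_div, ← sum_div, ← mul_sum]
  -- binomial-type resummations `Σ_u ∏_{i∈u} a_i = ∏_i (1 + a_i)`
  have key : ∀ a : Fin s → ℝ, ∑ u : Finset (Fin s), ∏ i ∈ u, a i = ∏ i, (1 + a i) := by
    intro a
    rw [prod_one_add, Finset.powerset_univ]
  have h1 : ∑ u : Finset (Fin s), ∑ m, ∑ n, ∏ i ∈ u, (1 - max (x m i) (x n i)) =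
      ∑ m, ∑ n, ∏ i, (2 - max (x m i) (x n i)) := by
    rw [sum_comm]
    refine sum_congr rfl fun m _ => ?_
    rw [sum_comm]
    refine sum_congr rfl fun n _ => ?_
    rw [key]
    exact prod_congr rfl fun i _ => by ring
  have h2 : ∑ u : Finset (Fin s), ∑ n, ∏ i ∈ u, (1 - x n i ^ 2) / 2 =
      ∑ n, ∏ i, (3 - x n i ^ 2) / 2 := by
    rw [sum_comm]
    refine sum_congr rfl fun n _ => ?_
    rw [key]
    exact prod_congr rfl fun i _ => by ring
  have h3 : ∑ u : Finset (Fin s), (1 / 3 : ℝ) ^ u.card = (4 / 3 : ℝ) ^ s := by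
    have := key fun _ => (1 / 3 : ℝ)
    simp_rw [prod_const] at this
    rw [this, Finset.card_univ, Fintype.card_fin]
    norm_num
  rw [h1, h2, h3]

/-! ### The `L₂` Koksma–Hlawka inequality -/

/-- `(z_u,1) ∈ [0,1]^s` for `z ∈ [0,1]^s`. [folklore] -/
private theorem projOne_mem_Icc' (u : Finset (Fin s)) {z : Fin s → ℝ}
    (hz : z ∈ Icc (0 : Fin s → ℝ) 1) : projOne u z ∈ Icc (0 : Fin s → ℝ) 1 := by
  have hz' : ∀ i, 0 ≤ z i ∧ z i ≤ 1 := fun i => ⟨hz.1 i, hz.2 i⟩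
  constructor <;> intro i <;> by_cases hi : i ∈ u <;>
    simp only [projOne, hi, if_true, if_false, Pi.zero_apply, Pi.one_apply] <;>
    first | exact (hz' i).1 | exact (hz' i).2 | exact zero_le_one | exact le_rfl

/-- `z ↦ (z_u,1)` is continuous. [folklore] -/
private theorem continuous_projOne' (u : Finset (Fin s)) :
    Continuous (projOne u : (Fin s → ℝ) → Fin s → ℝ) := by
  refine continuous_pi fun i => ?_
  by_cases hi : i ∈ u <;> simp only [projOne, hi, if_true, if_false] <;>
    first | exact continuous_apply i | exact continuous_const

/-- `z ↦ Δ_P(z_u,1)` is measurable (points of `[0,1)^s`). [folklore] -/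
private theorem measurable_boxDelta_projOne (hx1 : ∀ n i, x n i < 1) (u : Finset (Fin s)) :
    Measurable fun z => boxDelta x (projOne u z) := by
  have h : (fun z => boxDelta x (projOne u z)) = fun z =>
      (∑ n, ∏ i ∈ u, (if x n i < z i then (1 : ℝ) else 0)) / N - ∏ i ∈ u, z i := by
    funext z; exact boxDelta_projOne x hx1 u z
  rw [h]
  exact ((Finset.measurable_sum _ fun n _ =>
    Finset.measurable_prod u fun i _ => measurable_ind (x n i) i).div_const _).sub
    (Finset.measurable_prod u fun i _ => measurable_pi_apply i)

/-- Cauchy–Schwarz on one face: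
`|∫_{[0,1]^s} Δ_P(z_u,1) ∂_u f(z_u,1) dz| ≤ (∫ Δ_P(z_u,1)²)^{1/2} (∫ (∂_u f(z_u,1))²)^{1/2}`.
[folklore] -/
private theorem abs_integral_face_le (hx1 : ∀ n i, x n i < 1) {G : (Fin s → ℝ) → ℝ}
    (hG : ContinuousOn G (Icc 0 1)) (u : Finset (Fin s)) :
    |∫ z in Icc (0 : Fin s → ℝ) 1, boxDelta x (projOne u z) * G (projOne u z)| ≤
      Real.sqrt (faceL2Sq x u) *
        Real.sqrt (∫ z in Icc (0 : Fin s → ℝ) 1, G (projOne u z) ^ 2) := by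
  haveI := isFiniteMeasure_cube s
  set μ : Measure (Fin s → ℝ) := (volume : Measure (Fin s → ℝ)).restrict (Icc 0 1) with hμ
  have hΔm : Measurable fun z => boxDelta x (projOne u z) := measurable_boxDelta_projOne x hx1 u
  have hΔb : ∀ z ∈ Icc (0 : Fin s → ℝ) 1, |boxDelta x (projOne u z)| ≤ 1 := fun z hz =>
    (abs_boxDelta_le_starDiscrepancy x (projOne_mem_Icc' u hz)).trans (starDiscrepancy_le_one x)
  have hGc : ContinuousOn (fun z => G (projOne u z)) (Icc (0 : Fin s → ℝ) 1) :=
    hG.comp (continuous_projOne' u).continuousOn fun z hz => projOne_mem_Icc' u hz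
  obtain ⟨C, hC⟩ := isCompact_Icc.exists_bound_of_continuousOn hGc
  -- `MemLp 2` for the absolute values
  have hf : MemLp (fun z => |boxDelta x (projOne u z)|) (ENNReal.ofReal 2) μ :=
    MemLp.of_bound hΔm.aestronglyMeasurable.norm 1
      ((ae_restrict_iff' measurableSet_Icc).2 (Filter.Eventually.of_forall fun z hz => by
        rw [Real.norm_eq_abs, abs_abs]; exact hΔb z hz))
  have hg : MemLp (fun z => |G (projOne u z)|) (ENNReal.ofReal 2) μ :=
    MemLp.of_bound (hGc.aestronglyMeasurable measurableSet_Icc).norm C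
      ((ae_restrict_iff' measurableSet_Icc).2 (Filter.Eventually.of_forall fun z hz => by
        rw [Real.norm_eq_abs, abs_abs]; exact hC z hz))
  have hpq : (2 : ℝ).HolderConjugate 2 := by
    rw [Real.holderConjugate_iff]; norm_num
  have hH := integral_mul_le_Lp_mul_Lq_of_nonneg (μ := μ) hpq
    (Filter.Eventually.of_forall fun z => abs_nonneg _)
    (Filter.Eventually.of_forall fun z => abs_nonneg _) hf hg
  -- rewrite the `rpow`s as squares and square roots
  have e1 : (fun z => |boxDelta x (projOne u z)| ^ (2 : ℝ)) =
      fun z => boxDelta x (projOne u z) ^ 2 := by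
    funext z; rw [Real.rpow_two, sq_abs]
  have e2 : (fun z => |G (projOne u z)| ^ (2 : ℝ)) = fun z => G (projOne u z) ^ 2 := by
    funext z; rw [Real.rpow_two, sq_abs]
  rw [e1, e2, ← Real.sqrt_eq_rpow, ← Real.sqrt_eq_rpow] at hH
  calc |∫ z in Icc (0 : Fin s → ℝ) 1, boxDelta x (projOne u z) * G (projOne u z)|
      ≤ ∫ z in Icc (0 : Fin s → ℝ) 1, |boxDelta x (projOne u z) * G (projOne u z)| :=
        abs_integral_le_integral_abs
    _ = ∫ z in Icc (0 : Fin s → ℝ) 1, |boxDelta x (projOne u z)| * |G (projOne u z)| := by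
        congr 1; funext z; exact abs_mul _ _
    _ ≤ _ := hH

/-- **The `L₂` Koksma–Hlawka inequality, face by face** (Hlawka–Zaremba identity + Cauchy–Schwarz).
For `N ≥ 1` points `x_n ∈ [0,1)^s` and `f` with continuous mixed partial derivatives
`F u = ∂^{|u|}f/∂x_u` on `[0,1]^s` (`F ∅ = f`; hypotheses as in `hlawka_zaremba_identity`),
`|(1/N) Σ_n f(x_n) − ∫_{[0,1]^s} f|
  ≤ Σ_{∅≠u} (∫_{[0,1]^s} Δ_P(z_u,1)² dz)^{1/2} · (∫_{[0,1]^s} (∂_u f(z_u,1))² dz)^{1/2}`.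
[cite: DickPillichshammer2010, Prop. 2.17 and §2.4 p. 33 (`|I(f) − Q_N(f)| ≤ ‖f‖ ‖h‖`,
`∂_u h(x_u,1) = (−1)^{|u|+1} Δ_P(x_u,1)`)] -/
theorem koksma_hlawka_l2_faces (hN : 0 < N) {x : Fin N → Fin s → ℝ}
    (hx0 : ∀ n i, 0 ≤ x n i) (hx1 : ∀ n i, x n i < 1)
    {f : (Fin s → ℝ) → ℝ} {F : Finset (Fin s) → (Fin s → ℝ) → ℝ} (hF : F ∅ = f)
    (hFc : ∀ u, ContinuousOn (F u) (Icc 0 1))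
    (hFd : ∀ u i, i ∉ u → ∀ z ∈ Icc (0 : Fin s → ℝ) 1,
      HasDerivAt (fun t => F u (update z i t)) (F (insert i u) z) (z i)) :
    |(∑ n, f (x n)) / N - ∫ z in Icc (0 : Fin s → ℝ) 1, f z| ≤
      ∑ u ∈ univ.filter Finset.Nonempty, Real.sqrt (faceL2Sq x u) *
        Real.sqrt (∫ z in Icc (0 : Fin s → ℝ) 1, F u (projOne u z) ^ 2) := by
  rw [hlawka_zaremba_identity hN hx0 hx1 hF hFc hFd]
  refine (abs_sum_le_sum_abs _ _).trans (sum_le_sum fun u _ => ?_)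
  rw [abs_mul, abs_pow, abs_neg, abs_one, one_pow, one_mul]
  exact abs_integral_face_le x hx1 (hFc u) u

/-- **The `L₂` Koksma–Hlawka inequality** `|(1/N) Σ_n f(x_n) − ∫ f| ≤ D₂(P) · V₂(f)` with
Hickernell's generalised `L₂`-discrepancy `D₂(P)² = Σ_{∅≠u} ∫ Δ_P(z_u,1)² dz_u`
(`genL2DiscrepancySq`, computable in closed form by `genL2DiscrepancySq_eq`) and
`V₂(f)² = Σ_{∅≠u} ∫ (∂_u f(z_u,1))² dz_u`, for `N ≥ 1` points `x_n ∈ [0,1)^s` and `f` with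
continuous mixed partial derivatives (hypotheses as in `hlawka_zaremba_identity`).
[cite: Hickernell1998, eq. (5.1c) (`D₂`) with the error bound `|I(f) − Q(f)| ≤ D₂(P) V₂(f)`;
Lemieux2009, §5.6.1, eq. (5.23) and `E_n ≤ D_2(P_n) V_2(f)`] -/
theorem koksma_hlawka_l2 (hN : 0 < N) {x : Fin N → Fin s → ℝ}
    (hx0 : ∀ n i, 0 ≤ x n i) (hx1 : ∀ n i, x n i < 1)
    {f : (Fin s → ℝ) → ℝ} {F : Finset (Fin s) → (Fin s → ℝ) → ℝ} (hF : F ∅ = f)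
    (hFc : ∀ u, ContinuousOn (F u) (Icc 0 1))
    (hFd : ∀ u i, i ∉ u → ∀ z ∈ Icc (0 : Fin s → ℝ) 1,
      HasDerivAt (fun t => F u (update z i t)) (F (insert i u) z) (z i)) :
    |(∑ n, f (x n)) / N - ∫ z in Icc (0 : Fin s → ℝ) 1, f z| ≤
      Real.sqrt (genL2DiscrepancySq x) *
        Real.sqrt (∑ u ∈ univ.filter Finset.Nonempty,
          ∫ z in Icc (0 : Fin s → ℝ) 1, F u (projOne u z) ^ 2) := by
  refine (koksma_hlawka_l2_faces hN hx0 hx1 hF hFc hFd).trans ?_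
  set S : Finset (Finset (Fin s)) := univ.filter Finset.Nonempty with hS
  have hA : ∀ u, 0 ≤ faceL2Sq x u := fun u => integral_nonneg fun z => sq_nonneg _
  have hB : ∀ u : Finset (Fin s), 0 ≤ ∫ z in Icc (0 : Fin s → ℝ) 1, F u (projOne u z) ^ 2 :=
    fun u => integral_nonneg fun z => sq_nonneg _
  have hCS := sum_mul_sq_le_sq_mul_sq S (fun u => Real.sqrt (faceL2Sq x u))
    (fun u => Real.sqrt (∫ z in Icc (0 : Fin s → ℝ) 1, F u (projOne u z) ^ 2))
  simp_rw [Real.sq_sqrt (hA _), Real.sq_sqrt (hB _)] at hCS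
  have hnn : 0 ≤ ∑ u ∈ S, Real.sqrt (faceL2Sq x u) *
      Real.sqrt (∫ z in Icc (0 : Fin s → ℝ) 1, F u (projOne u z) ^ 2) :=
    sum_nonneg fun u _ => mul_nonneg (Real.sqrt_nonneg _) (Real.sqrt_nonneg _)
  have hgen : genL2DiscrepancySq x = ∑ u ∈ S, faceL2Sq x u := rfl
  rw [hgen]
  calc ∑ u ∈ S, Real.sqrt (faceL2Sq x u) *
          Real.sqrt (∫ z in Icc (0 : Fin s → ℝ) 1, F u (projOne u z) ^ 2)
      = Real.sqrt ((∑ u ∈ S, Real.sqrt (faceL2Sq x u) *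
          Real.sqrt (∫ z in Icc (0 : Fin s → ℝ) 1, F u (projOne u z) ^ 2)) ^ 2) :=
        (Real.sqrt_sq hnn).symm
    _ ≤ Real.sqrt ((∑ u ∈ S, faceL2Sq x u) *
          ∑ u ∈ S, ∫ z in Icc (0 : Fin s → ℝ) 1, F u (projOne u z) ^ 2) :=
        Real.sqrt_le_sqrt hCS
    _ = _ := Real.sqrt_mul (sum_nonneg fun u _ => hA u) _

end Discrepancy

end Literature.NumberTheory.DiophantineApproximation
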